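import Summits.ResolutionOfSingularities.ResolutionOfSingularities.Theorems.PurelyInseparableDim4ChartAtlasSNCFarRepairState
import Summits.ResolutionOfSingularities.ResolutionOfSingularities.Theorems.PurelyInseparableDim4CentreAdmissible
import HarnessLib

/-!
# Purely inseparable four-folds `z^p + F(x₁, …, x₄)`: STRAIGHTENING THE FIBRE PART OF AN ENTRY — the step at the point `b` of the `x_j`-chart
# equals the step at its BASE part `b̃` for the state SHEARED by `σ_β` (cell `res-dim4-pi`, typ-2 g8; chart-dictionary side of typ-3 g8's E-V4-4
# (a), memo S3c-V4 §16: «a sheared escaping entry is a linear entry at a sheared parent reading»)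

[OURS · counted 0] (D-0157 DOOR 2; DR-157-C.) Setting: a coordinate-centre step of the tree's walk, centre `V(z, x_T)`, chart `j ∈ T`, point
`b` with `b_j = 0`; split `b = β + b̃` with `β = b·𝟙_{T∖j}` (fibre part) and `b̃ = b·𝟙_{∉T}` (base part). The linear substitution
`σ_β : xᵢ ↦ xᵢ + βᵢ·x_j` (`i ∈ T ∖ j`), identity on the other variables, preserves the ideal `(x_T)`. PROVED here (no `sorry`, no new axiom):

* `coordBlowupSubst_shear` — on the `x_j`-chart, `ψ_j ∘ σ_β = (translation by β) ∘ ψ_j`;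
* `le_ordAlong_shear` — `σ_β` keeps `T`-permissibility (`(x_T)^p ↦ (x_T)^p`; Literature `mem_pow_span_X_iff`);
* `chartTransform_shear` — `chartTransform p T j (σ_β F) = (chartTransform p T j F)(y + β)`;
* `step_F_eq_step_deletePthPowers` — cleaning before a step at ANY point of the chart does not change the step's `F` (p725203 did `b = 0`);
* **`step_shear_F_eq`** — `(CentreBlowup.step p T j b s).F = (CentreBlowup.step p T j b̃ ⟨deletePthPowers p (σ_β s.F), s.r, s.exc⟩).F` — E-V4-4 (a) on
  the main chart, `F`-component (the `r`/`exc` components agree when `β` vanishes on the indices carrying exceptional components, typ-3's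
  normalisation (b); not asserted here).

Nothing here is a statement about resolution of singularities in dimension ≥ 4 / characteristic `p` (NOT proved anywhere in this programme).
bears_on: LADDER-RESOLUTION:D157-DOOR2 (res-dim4-pi). Supports stmt-ResolutionOfSingularities-16155 (helper).
-/

-- every declaration of this summit lives under `Summit.ResolutionOfSingularities.ResolutionOfSingularities`
-- (summit = problem), which the duplicate-namespace linter flags; house convention (cf. the Target file).
set_option linter.dupNamespace false

noncomputable section

open MvPolynomial

namespace Summit.ResolutionOfSingularities.ResolutionOfSingularities.Theorems.PIDim4

open Literature.AlgebraicGeometry.Resolution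
open Literature.AlgebraicGeometry.Resolution.Hauser2010
open Literature.Barriers.ResolutionOfSingularities
open Literature.AlgebraicGeometry.Hironaka2017.CoordArrangement

namespace ChartDictionary

variable {K : Type} [Field K] {p : ℕ} [hp : Fact p.Prime] {T : Finset (Fin 4)} {j : Fin 4} {b : Fin 4 → K}

/-! ## §1 The shear and the chart substitution -/

omit hp in
/-- **On the `x_j`-chart, `ψ_j ∘ σ_β = (translation by the fibre part) ∘ ψ_j`**: `ψ_j(σ_β Q) = (ψ_j Q)(x + β)`, `β = b·𝟙_{T∖j}`. -/
theorem coordBlowupSubst_shear [DecidableEq K] (hj : j ∈ T) (Q : MvPolynomial (Fin 4) K) :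
    coordBlowupSubst K (T : Set (Fin 4)) j (aeval (fun i => if i ∈ T ∧ i ≠ j then X i + C (b i) * X j else (X i : MvPolynomial (Fin 4) K)) Q) =
      PointBlowup.translate (fun i => if i ∈ T ∧ i ≠ j then b i else 0) (coordBlowupSubst K (T : Set (Fin 4)) j Q) := by
  classical
  have key : (coordBlowupSubst K (T : Set (Fin 4)) j).comp
      (aeval fun i => if i ∈ T ∧ i ≠ j then X i + C (b i) * X j else (X i : MvPolynomial (Fin 4) K)) =
      (aeval fun i => (X i + C ((fun i => if i ∈ T ∧ i ≠ j then b i else 0) i) : MvPolynomial (Fin 4) K)).comp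
        (coordBlowupSubst K (T : Set (Fin 4)) j) := by
    refine MvPolynomial.algHom_ext fun i => ?_
    rw [AlgHom.comp_apply, AlgHom.comp_apply, aeval_X]
    by_cases hi : i ∈ T ∧ i ≠ j
    · have hjj : ¬ (j ∈ T ∧ j ≠ j) := fun h => h.2 rfl
      have e2 : (fun i => if i ∈ T ∧ i ≠ j then b i else (0 : K)) i = b i := if_pos hi
      have e3 : (fun i => if i ∈ T ∧ i ≠ j then b i else (0 : K)) j = 0 := if_neg hjj
      rw [if_pos hi, map_add, map_mul, coordBlowupSubst_C, coordBlowupSubst_X_of_mem_of_ne K _ j (Finset.mem_coe.mpr hi.1) hi.2,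
        coordBlowupSubst_X_self, map_mul, aeval_X, aeval_X, e2, e3, C_0, add_zero]
      ring
    · have e2 : (fun i => if i ∈ T ∧ i ≠ j then b i else (0 : K)) i = 0 := if_neg hi
      rw [if_neg hi]
      by_cases hij : i = j
      · subst hij
        rw [coordBlowupSubst_X_self, aeval_X, e2, C_0, add_zero]
      · have hiT : i ∉ (T : Set (Fin 4)) := fun h => hi ⟨Finset.mem_coe.mp h, hij⟩
        rw [coordBlowupSubst_X_of_not_mem K _ j hiT, aeval_X, e2, C_0, add_zero]
  have h := congrArg (fun f : MvPolynomial (Fin 4) K →ₐ[K] MvPolynomial (Fin 4) K => f Q) key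
  simp only [AlgHom.comp_apply] at h
  unfold PointBlowup.translate
  exact h

omit hp in
/-- **`σ_β` keeps `T`-permissibility**: `q ≤ ord_{(x_T)} F ⇒ q ≤ ord_{(x_T)} (σ_β F)` (`σ_β` maps `(x_T)` into itself, `j ∈ T`). -/
theorem le_ordAlong_shear [DecidableEq K] (hj : j ∈ T) {q : ℕ} {F : MvPolynomial (Fin 4) K} (hperm : (q : ℕ∞) ≤ CentreBlowup.ordAlong T F) :
    (q : ℕ∞) ≤ CentreBlowup.ordAlong T
      (aeval (fun i => if i ∈ T ∧ i ≠ j then X i + C (b i) * X j else (X i : MvPolynomial (Fin 4) K)) F) := by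
  classical
  set σβ : MvPolynomial (Fin 4) K →ₐ[K] MvPolynomial (Fin 4) K :=
    aeval fun i => if i ∈ T ∧ i ≠ j then X i + C (b i) * X j else (X i : MvPolynomial (Fin 4) K) with hσ
  have hI : (Ideal.span (X '' (T : Set (Fin 4)) : Set (MvPolynomial (Fin 4) K))).map σβ ≤ Ideal.span (X '' (T : Set (Fin 4))) := by
    rw [Ideal.map_span]
    refine Ideal.span_le.mpr ?_
    rintro _ ⟨_, ⟨i, hi, rfl⟩, rfl⟩
    change σβ (X i) ∈ Ideal.span (X '' (T : Set (Fin 4)))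
    rw [hσ, aeval_X]
    by_cases hij : i = j
    · subst hij
      simp only [show ¬ (i ∈ T ∧ i ≠ i) from fun h => h.2 rfl, if_false]
      exact Ideal.subset_span ⟨i, hi, rfl⟩
    · rw [if_pos ⟨Finset.mem_coe.mp hi, hij⟩]
      exact Ideal.add_mem _ (Ideal.subset_span ⟨i, hi, rfl⟩) (Ideal.mul_mem_left _ _ (Ideal.subset_span ⟨j, Finset.mem_coe.mpr hj, rfl⟩))
  have hmem : σβ F ∈ Ideal.span (X '' (T : Set (Fin 4)) : Set (MvPolynomial (Fin 4) K)) ^ q := by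
    have h1 : σβ F ∈ (Ideal.span (X '' (T : Set (Fin 4)) : Set (MvPolynomial (Fin 4) K)) ^ q).map σβ :=
      Ideal.mem_map_of_mem _ (mem_pow_span_X_of_le_ordAlong q T F hperm)
    rw [Ideal.map_pow] at h1
    exact Ideal.pow_right_mono hI q h1
  rw [CentreBlowup.le_ordAlong_iff]
  intro d hd
  have h := (mem_pow_span_X_iff.mp hmem) d hd
  rw [sdeg_coe_eq_degIn] at h
  exact_mod_cast h

omit hp in
/-- **The chart transform of the sheared polynomial is the translated chart transform**: `chartTransform p T j (σ_β F) = (chartTransform p T j F)(y + β)`. -/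
theorem chartTransform_shear [DecidableEq K] (hj : j ∈ T) {F : MvPolynomial (Fin 4) K} (hperm : (p : ℕ∞) ≤ CentreBlowup.ordAlong T F) :
    CentreBlowup.chartTransform p T j (aeval (fun i => if i ∈ T ∧ i ≠ j then X i + C (b i) * X j else (X i : MvPolynomial (Fin 4) K)) F) =
      PointBlowup.translate (fun i => if i ∈ T ∧ i ≠ j then b i else 0) (CentreBlowup.chartTransform p T j F) := by
  classical
  have h1 := coordBlowupSubst_eq_X_pow_mul_chartTransform hj p _ (le_ordAlong_shear (b := b) hj hperm)
  rw [coordBlowupSubst_shear hj, coordBlowupSubst_eq_X_pow_mul_chartTransform hj p F hperm] at h1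
  have h2 : PointBlowup.translate (fun i => if i ∈ T ∧ i ≠ j then b i else 0) (X j ^ p * CentreBlowup.chartTransform p T j F) =
      X j ^ p * PointBlowup.translate (fun i => if i ∈ T ∧ i ≠ j then b i else 0) (CentreBlowup.chartTransform p T j F) := by
    unfold PointBlowup.translate
    rw [map_mul, map_pow, aeval_X]
    simp only [show ¬ (j ∈ T ∧ j ≠ j) from fun h => h.2 rfl, if_false, C_0, add_zero]
  rw [h2] at h1
  exact (mul_left_cancel₀ (pow_ne_zero p (X_ne_zero j)) h1).symm

/-! ## §2 The step identity -/

/-- **Cleaning before a step does not change the step's polynomial**, at ANY point `b` of the chart (p725203 `step_zero_F_eq_step_deletePthPowers` is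
`b = 0`): the chart transform of the `p`-th power part is a sum of `p`-th powers, so is its translate, and the final cleaning deletes it. -/
theorem step_F_eq_step_deletePthPowers [CharP K p] [DecidableEq K] (S : Finset (Fin 4)) (j : Fin 4) (b : Fin 4 → K) (s : State K) :
    (CentreBlowup.step p S j b s).F = (CentreBlowup.step p S j b ⟨deletePthPowers p s.F, s.r, s.exc⟩).F := by
  classical
  change deletePthPowers p (PointBlowup.translate b (CentreBlowup.chartTransform p S j s.F)) =
    deletePthPowers p (PointBlowup.translate b (CentreBlowup.chartTransform p S j (deletePthPowers p s.F)))
  conv_lhs => rw [show s.F = deletePthPowers p s.F + (s.F - deletePthPowers p s.F) by rw [add_sub_cancel]]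
  rw [CentreBlowup.chartTransform_add, MohAlong.translate_add, deletePthPowers_add,
    Equimultiple.deletePthPowers_translate_eq_zero b
      (deletePthPowers_chartTransform_eq_zero S j (isPthPowerExponent_of_mem_support_sub_deletePthPowers s.F)), add_zero]

/-- **E-V4-4 (a), `F`-component: THE STEP AT `b` IS THE STEP AT THE BASE PART `b̃` FOR THE SHEARED, RE-CLEANED STATE.** `j ∈ T`, `b_j = 0`,
`p ≤ ord_{(x_T)} s.F`: `(step p T j b s).F = (step p T j b̃ ⟨deletePthPowers p (σ_β s.F), s.r, s.exc⟩).F`, `b̃ = b·𝟙_{∉T}`,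
`σ_β = [xᵢ ↦ xᵢ + bᵢ x_j (i ∈ T ∖ j)]`. -/
theorem step_shear_F_eq [CharP K p] [DecidableEq K] (hj : j ∈ T) (hbj : b j = 0) (s : State K)
    (hperm : (p : ℕ∞) ≤ CentreBlowup.ordAlong T s.F) :
    (CentreBlowup.step p T j b s).F =
      (CentreBlowup.step p T j (fun i => if i ∈ T then 0 else b i)
        ⟨deletePthPowers p (aeval (fun i => if i ∈ T ∧ i ≠ j then X i + C (b i) * X j else (X i : MvPolynomial (Fin 4) K)) s.F),
          s.r, s.exc⟩).F := by
  classical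
  rw [← step_F_eq_step_deletePthPowers T j (fun i => if i ∈ T then 0 else b i)
    ⟨aeval (fun i => if i ∈ T ∧ i ≠ j then X i + C (b i) * X j else (X i : MvPolynomial (Fin 4) K)) s.F, s.r, s.exc⟩]
  change deletePthPowers p (PointBlowup.translate b (CentreBlowup.chartTransform p T j s.F)) =
    deletePthPowers p (PointBlowup.translate (fun i => if i ∈ T then 0 else b i) (CentreBlowup.chartTransform p T j
      (aeval (fun i => if i ∈ T ∧ i ≠ j then X i + C (b i) * X j else (X i : MvPolynomial (Fin 4) K)) s.F)))
  rw [chartTransform_shear hj hperm, MohAlong.translate_translate]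
  congr 3
  funext i
  show b i = (if i ∈ T then 0 else b i) + (if i ∈ T ∧ i ≠ j then b i else 0)
  by_cases hiT : i ∈ T
  · by_cases hij : i = j
    · subst hij
      rw [if_pos hiT, if_neg (fun h : i ∈ T ∧ i ≠ i => h.2 rfl), add_zero]
      exact hbj
    · rw [if_pos hiT, if_pos ⟨hiT, hij⟩, zero_add]
  · rw [if_neg hiT, if_neg (fun h : i ∈ T ∧ i ≠ j => hiT h.1), add_zero]

end ChartDictionary

end Summit.ResolutionOfSingularities.ResolutionOfSingularities.Theorems.PIDim4

end
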